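import Mathlib.Logic.Relation
import Mathlib.Data.Fintype.Basic
import Mathlib.Data.Finset.Basic
import Literature.Probability.LatticeModels.CoarseCellFiniteSize
import HarnessLib

/-!
# Coarse-cell mixing with defects: bad clusters attached to a seed (the combinatorics)

Companion ("theorems only", pure combinatorics) file of the coarse-cell defect series
(`CoarseCellMixingDefects{BlockLeak,Chain,Steps,Floor}`). An expansion around Peierls-rare bad
cells decomposes a configuration according to the BAD CLUSTER ATTACHED TO A SEED (the shell of the
block being resampled): the set of bad cells reachable from a bad seed cell by steps of a linking
relation (coarse distance `≤ ρ`) through bad cells. This file isolates that closure and the two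
facts the expansion uses:

* `seedClosure adj B S` — the cells of `B` ("bad") reachable from a cell of `S ∩ B` ("bad seed")
  by `adj`-steps inside `B`; it lies in `B`, contains `S ∩ B`, is closed (a cell of `B` linked to
  it belongs to it), is monotone in `B`, and each of its cells is linked to a seed cell by a chain
  INSIDE the closure (`seedClosure_connected`, the input of the lattice-animal count
  `LatticeAnimals.card_connectedFamily_le`);
* `seedClosure_eq_iff` — the RECTANGLE LEMMA: for a set `K` equal to its own closure from the seed,
  the event "the bad cluster attached to `S` is exactly `K`" is the product event "every cell of
  `K` is bad and every cell of `S ∪ N_adj(K)` outside `K` is good" — so its kernel probability is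
  bounded by a Peierls bound on `K` alone, and its indicator splits into cell-local factors;
* `badCluster`, `badCluster_eq_iff` — the specialisation to cells of a coarse torus read through
  `cell : V → CoarseIdx μ`, goodness sets `good c`, and the link `cdist ≤ ρ`.

## References

* R. L. Dobrushin, *Estimates of semi-invariants for the Ising model at low temperatures*,
  AMS Transl. 177 (1996) (cluster/contour decompositions); S. Friedli, Y. Velenik, *Statistical
  Mechanics of Lattice Systems* (CUP 2017), §3.7.2 and §5.7 (Peierls contours, polymers).
-/

noncomputable section

open scoped Classical

namespace Literature.Probability.LatticeModels

/-! ### The closure of a seed inside a set under a linking relation -/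

section SeedClosure

variable {α : Type*} (adj : α → α → Prop)

/-- The linking relation restricted to targets in `B`: one `adj`-step landing in `B`. [folklore] -/
def stepIn (B : Finset α) (x y : α) : Prop := adj x y ∧ y ∈ B

/-- **The cluster of `B` attached to the seed `S`**: the cells of `B` reachable from some cell of
`S ∩ B` by a chain of `adj`-steps all landing in `B`. [folklore] -/
def seedClosure (B S : Finset α) : Finset α :=
  B.filter fun c => ∃ s ∈ S, s ∈ B ∧ Relation.ReflTransGen (stepIn adj B) s c

variable {adj}

/-- Membership in the seed closure. [folklore] -/
theorem mem_seedClosure {B S : Finset α} {c : α} :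
    c ∈ seedClosure adj B S ↔ c ∈ B ∧ ∃ s ∈ S, s ∈ B ∧ Relation.ReflTransGen (stepIn adj B) s c := by
  simp [seedClosure]

/-- The seed closure lies inside `B`. [folklore] -/
theorem seedClosure_subset (B S : Finset α) : seedClosure adj B S ⊆ B :=
  Finset.filter_subset _ _

/-- The bad seed cells belong to the closure. [folklore] -/
theorem inter_subset_seedClosure (B S : Finset α) : S ∩ B ⊆ seedClosure adj B S := fun s hs => by
  rw [Finset.mem_inter] at hs
  exact mem_seedClosure.2 ⟨hs.2, s, hs.1, hs.2, Relation.ReflTransGen.refl⟩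

/-- A chain of steps landing in `B` ends in `B` (or did not move). [folklore] -/
theorem mem_of_reflTransGen_stepIn {B : Finset α} {s c : α} (hs : s ∈ B)
    (h : Relation.ReflTransGen (stepIn adj B) s c) : c ∈ B := by
  induction h with
  | refl => exact hs
  | tail _ hbc _ => exact hbc.2

/-- **Closedness**: a cell of `B` linked to a cell of the closure belongs to the closure.
[folklore] -/
theorem mem_seedClosure_of_adj {B S : Finset α} {k c : α} (hk : k ∈ seedClosure adj B S)
    (hkc : adj k c) (hc : c ∈ B) : c ∈ seedClosure adj B S := by
  obtain ⟨-, s, hsS, hsB, hchain⟩ := mem_seedClosure.1 hk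
  exact mem_seedClosure.2 ⟨hc, s, hsS, hsB, hchain.tail ⟨hkc, hc⟩⟩

/-- **Monotonicity in `B`**: enlarging the bad set enlarges the closure. [folklore] -/
theorem seedClosure_mono {B B' : Finset α} (hBB' : B ⊆ B') (S : Finset α) :
    seedClosure adj B S ⊆ seedClosure adj B' S := fun c hc => by
  obtain ⟨hcB, s, hsS, hsB, hchain⟩ := mem_seedClosure.1 hc
  refine mem_seedClosure.2 ⟨hBB' hcB, s, hsS, hBB' hsB, ?_⟩
  clear hc hcB
  induction hchain with
  | refl => exact Relation.ReflTransGen.refl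
  | tail _ hbc ih => exact Relation.ReflTransGen.tail ih ⟨hbc.1, hBB' hbc.2⟩

/-- **Induction principle / minimality**: a property holding on the bad seed cells and
propagating along links inside `B` holds on the whole closure. [folklore] -/
theorem seedClosure_induction {B S : Finset α} {P : α → Prop} (hseed : ∀ s ∈ S, s ∈ B → P s)
    (hstep : ∀ x y, P x → adj x y → y ∈ B → P y) {c : α} (hc : c ∈ seedClosure adj B S) : P c := by
  obtain ⟨-, s, hsS, hsB, hchain⟩ := mem_seedClosure.1 hc
  clear hc
  induction hchain with
  | refl => exact hseed s hsS hsB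
  | tail _ hbc ih => exact hstep _ _ ih hbc.1 hbc.2

/-- The closure is contained in every subset of `B` containing the bad seed cells and closed under
links inside `B`. [folklore] -/
theorem seedClosure_subset_of_closed {B S K : Finset α} (hseed : S ∩ B ⊆ K)
    (hclosed : ∀ x ∈ K, ∀ y ∈ B, adj x y → y ∈ K) : seedClosure adj B S ⊆ K := fun _ hc =>
  seedClosure_induction (P := fun x => x ∈ K) (fun _ hsS hsB => hseed (Finset.mem_inter.2 ⟨hsS, hsB⟩))
    (fun x y hx hxy hy => hclosed x hx y hy hxy) hc

/-- **Connectedness inside the closure**: every cell of the closure is joined to a seed cell of the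
closure by a chain of links all of whose cells lie in the closure (the form consumed by the
lattice-animal count `LatticeAnimals.card_connectedFamily_le`). [folklore] -/
theorem seedClosure_connected {B S : Finset α} {c : α} (hc : c ∈ seedClosure adj B S) :
    ∃ s ∈ S, s ∈ seedClosure adj B S ∧
      Relation.ReflTransGen (fun x y => adj x y ∧ x ∈ seedClosure adj B S ∧
        y ∈ seedClosure adj B S) s c := by
  obtain ⟨-, s, hsS, hsB, hchain⟩ := mem_seedClosure.1 hc
  have hsK : s ∈ seedClosure adj B S :=
    inter_subset_seedClosure B S (Finset.mem_inter.2 ⟨hsS, hsB⟩)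
  refine ⟨s, hsS, hsK, ?_⟩
  -- every cell along the chain is in the closure
  clear hc
  induction hchain with
  | refl => exact Relation.ReflTransGen.refl
  | tail hab hbc ih =>
    have hbK : _ ∈ seedClosure adj B S :=
      mem_seedClosure.2 ⟨mem_of_reflTransGen_stepIn hsB hab, s, hsS, hsB, hab⟩
    exact Relation.ReflTransGen.tail ih ⟨hbc.1, hbK, mem_seedClosure_of_adj hbK hbc.1 hbc.2⟩

/-- The closure only depends on the bad seed cells. [folklore] -/
theorem seedClosure_inter (B S : Finset α) : seedClosure adj B (S ∩ B) = seedClosure adj B S := by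
  ext c
  simp only [mem_seedClosure, Finset.mem_inter]
  constructor
  · rintro ⟨hc, s, ⟨hsS, -⟩, hsB, h⟩; exact ⟨hc, s, hsS, hsB, h⟩
  · rintro ⟨hc, s, hsS, hsB, h⟩; exact ⟨hc, s, ⟨hsS, hsB⟩, hsB, h⟩

/-- A set `K` is a **cluster shape for the seed `S`** if it is its own closure from `S` (every cell
of `K` is linked to a cell of `S ∩ K` through `K`); these are exactly the possible values of the
attached cluster (`isClusterShape_seedClosure`). [folklore] -/
def IsClusterShape (adj : α → α → Prop) (S K : Finset α) : Prop := seedClosure adj K S = K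

/-- The attached cluster of any bad set is a cluster shape. [folklore] -/
theorem isClusterShape_seedClosure (B S : Finset α) : IsClusterShape adj S (seedClosure adj B S) := by
  set K := seedClosure adj B S with hK
  refine Finset.Subset.antisymm (seedClosure_subset K S) fun c hc => ?_
  obtain ⟨s, hsS, hsK, hchain⟩ := seedClosure_connected hc
  refine mem_seedClosure.2 ⟨hc, s, hsS, hsK, ?_⟩
  clear hc
  induction hchain with
  | refl => exact Relation.ReflTransGen.refl
  | tail _ hbc ih => exact Relation.ReflTransGen.tail ih ⟨hbc.1, hbc.2.2⟩

/-- **The rectangle lemma.** For a cluster shape `K` of the seed `S`, the cluster of `B` attached to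
`S` equals `K` if and only if `K ⊆ B` (every cell of `K` is bad) and every cell of `B` outside `K`
is neither a seed cell nor linked to a cell of `K` (every seed cell and every neighbour of `K`
outside `K` is good). [folklore] -/
theorem seedClosure_eq_iff {S K : Finset α} (hK : IsClusterShape adj S K) (B : Finset α) :
    seedClosure adj B S = K ↔
      K ⊆ B ∧ ∀ c ∈ B, c ∉ K → c ∉ S ∧ ∀ k ∈ K, ¬ adj k c := by
  constructor
  · intro h
    refine ⟨h ▸ seedClosure_subset B S, fun c hcB hcK => ⟨fun hcS => hcK ?_, fun k hk hkc => hcK ?_⟩⟩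
    · exact h ▸ inter_subset_seedClosure B S (Finset.mem_inter.2 ⟨hcS, hcB⟩)
    · exact h ▸ mem_seedClosure_of_adj (h.symm ▸ hk) hkc hcB
  · rintro ⟨hKB, hout⟩
    refine Finset.Subset.antisymm ?_ ?_
    · -- the closure in `B` stays inside `K`
      refine seedClosure_subset_of_closed (fun s hs => ?_) (fun x hx y hyB hxy => ?_)
      · rw [Finset.mem_inter] at hs
        by_contra hsK
        exact (hout s hs.2 hsK).1 hs.1
      · by_contra hyK
        exact (hout y hyB hyK).2 x hx hxy
    · -- `K`, its own closure, lies in the closure in the larger `B`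
      calc K = seedClosure adj K S := hK.symm
        _ ⊆ seedClosure adj B S := seedClosure_mono hKB S

/-- For a cluster shape, every cell of `K` is joined to a seed cell in `K` by a chain of links
inside `K`. [folklore] -/
theorem IsClusterShape.connected {S K : Finset α} (hK : IsClusterShape adj S K) {c : α}
    (hc : c ∈ K) :
    ∃ s ∈ S, s ∈ K ∧ Relation.ReflTransGen (fun x y => adj x y ∧ x ∈ K ∧ y ∈ K) s c := by
  have hc' : c ∈ seedClosure adj K S := hK.symm ▸ hc
  obtain ⟨s, hsS, hsK, hchain⟩ := seedClosure_connected hc'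
  rw [hK] at hsK hchain
  exact ⟨s, hsS, hsK, hchain⟩

end SeedClosure

/-! ### Bad clusters of a configuration on the coarse torus -/

section Cells

variable {d : ℕ} {μc : Fin d → ℕ} {V S : Type*}

/-- **The bad cluster attached to the seed cells `Sd` at linking range `ρ`**, among the cells of
the finite universe `U` (e.g. the resampled cells): the cells of `U` bad for `σ`, reachable from a
bad seed cell by steps of coarse length `≤ ρ` through bad cells of `U`. [folklore] -/
def badCluster (good : CoarseIdx μc → Set (V → S)) (ρ : ℕ) (U Sd : Finset (CoarseIdx μc))
    (σ : V → S) : Finset (CoarseIdx μc) :=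
  seedClosure (fun x y : CoarseIdx μc => cdist x y ≤ ρ) (U.filter fun c => σ ∉ good c) Sd

/-- The bad cluster consists of bad cells of the universe. [folklore] -/
theorem badCluster_subset (good : CoarseIdx μc → Set (V → S)) (ρ : ℕ) (U Sd : Finset (CoarseIdx μc))
    (σ : V → S) : badCluster good ρ U Sd σ ⊆ U.filter fun c => σ ∉ good c :=
  seedClosure_subset _ _

/-- The bad cluster is a cluster shape for its seed (so the decomposition by its value ranges over
cluster shapes only). [folklore] -/
theorem isClusterShape_badCluster (good : CoarseIdx μc → Set (V → S)) (ρ : ℕ)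
    (U Sd : Finset (CoarseIdx μc)) (σ : V → S) :
    IsClusterShape (fun x y : CoarseIdx μc => cdist x y ≤ ρ) Sd (badCluster good ρ U Sd σ) :=
  isClusterShape_seedClosure _ _

/-- **The rectangle lemma for bad clusters.** For a cluster shape `K ⊆ U` of the seed `Sd`, the bad
cluster of `σ` attached to `Sd` is exactly `K` if and only if every cell of `K` is bad for `σ` and
every cell of `U` outside `K` that is a seed cell or within coarse distance `ρ` of `K` is good for
`σ` — a product of cell events, whose kernel probability a Peierls bound on `K` controls.
[folklore] -/
theorem badCluster_eq_iff {good : CoarseIdx μc → Set (V → S)} {ρ : ℕ} {U Sd K : Finset (CoarseIdx μc)}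
    (hK : IsClusterShape (fun x y : CoarseIdx μc => cdist x y ≤ ρ) Sd K) (hKU : K ⊆ U)
    (σ : V → S) :
    badCluster good ρ U Sd σ = K ↔
      (∀ c ∈ K, σ ∉ good c) ∧
        ∀ c ∈ U, c ∉ K → (c ∈ Sd ∨ ∃ k ∈ K, cdist k c ≤ ρ) → σ ∈ good c := by
  rw [badCluster, seedClosure_eq_iff hK]
  constructor
  · rintro ⟨hKB, hout⟩
    refine ⟨fun c hc => (Finset.mem_filter.1 (hKB hc)).2, fun c hcU hcK hc => ?_⟩
    by_contra hbad
    obtain ⟨hS, hadj⟩ := hout c (Finset.mem_filter.2 ⟨hcU, hbad⟩) hcK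
    rcases hc with h | ⟨k, hk, hkc⟩
    · exact hS h
    · exact hadj k hk hkc
  · rintro ⟨hbad, hgood⟩
    refine ⟨fun c hc => Finset.mem_filter.2 ⟨hKU hc, hbad c hc⟩, fun c hcB hcK => ?_⟩
    obtain ⟨hcU, hcbad⟩ := Finset.mem_filter.1 hcB
    refine ⟨fun hcS => hcbad (hgood c hcU hcK (Or.inl hcS)), fun k hk hkc => ?_⟩
    exact hcbad (hgood c hcU hcK (Or.inr ⟨k, hk, hkc⟩))

/-- The bad cluster is empty iff every seed cell of the universe is good. [folklore] -/
theorem badCluster_eq_empty_iff (good : CoarseIdx μc → Set (V → S)) (ρ : ℕ)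
    (U Sd : Finset (CoarseIdx μc)) (σ : V → S) :
    badCluster good ρ U Sd σ = ∅ ↔ ∀ c ∈ Sd, c ∈ U → σ ∈ good c := by
  have hK : IsClusterShape (fun x y : CoarseIdx μc => cdist x y ≤ ρ) Sd ∅ := by
    simp [IsClusterShape, seedClosure]
  rw [badCluster_eq_iff hK (Finset.empty_subset U)]
  simp only [Finset.notMem_empty, false_imp_iff, implies_true, not_false_eq_true, true_and,
    false_and, exists_false, or_false, forall_true_left]
  exact ⟨fun h c hcS hcU => h c hcU hcS, fun h c hcU hcS => h c hcS hcU⟩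

end Cells

end Literature.Probability.LatticeModels
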